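import Literature.MathematicalPhysics.QuantumManyBody.JelliumBoxReduction
import Literature.MathematicalPhysics.QuantumManyBody.CoulombCutoffLemma
import HarnessLib

/-!
# Lieb–Solovej Lemma 4.1: long and short distance cutoffs in the one-box Hamiltonian

Topic `Literature/MathematicalPhysics/QuantumManyBody` (the charged Bose gas, `JelliumBoseGas.foldyLaw`).
[LiebSolovej2001, §4]: in the one-box Hamiltonian `H^n_ℓ` (3.9) the kernel `Y_{ω/ℓ}` of
`w(x,y) = θ(x)Y(x-y)θ(y)` is replaced by the doubly cut-off kernel
`V_{r,R} = Y_{R⁻¹} - Y_{r⁻¹} = (e^{-|x|/R} - e^{-|x|/r})/|x|` (4.2), `0 < r ≤ R ≤ (ω/ℓ)⁻¹`, giving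
`H^n_{ℓ,r,R}` (4.5), at the cost [LiebSolovej2001, Lemma 4.1]

`H^n_ℓ ≥ H^n_{ℓ,r,R} - ½ n R⁻¹ - const₁ n ρ r²`   (`const₁ = 4π` here).

This file introduces the one-box functional with a GENERAL pair kernel `K` (`pairK`, `backgroundK`,
`oneBodyK`, `selfEnergyK`, `boxEnergyK`, `boxGroundStateEnergyK`; the objects of
`JelliumBoxHamiltonian.lean` are the case `K = Y_ν`, definitionally), the cutoff kernel
`cutoffKernel r R = V_{r,R}`, and proves Lemma 4.1 for the quadratic forms and for the bosonic
ground-state energies, from the electrostatic inequality `Coulomb.coulombCutoff_electrostatic`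
((4.3)–(4.4), weights `cᵢ = θ(xᵢ)`, background `ρθ`) integrated against `|Φ|²`.

* `JelliumBoseGas.cutoff_electrostatic_pointwise` — (4.3)+(4.4) for a configuration of distinct
  points in the box vocabulary;
* `JelliumBoseGas.boxEnergyK_cutoff_le` — **Lemma 4.1 for the quadratic form** of every Neumann
  trial state;
* `JelliumBoseGas.boxGroundStateEnergyK_cutoff_le` — **Lemma 4.1**:
  `inf Spec H^n_{ℓ,r,R} - g n(½R⁻¹ + 4πρr²) ≤ inf Spec H^n_ℓ` (coupling `g`).

## References

* [LiebSolovej2001] E. H. Lieb, J. P. Solovej, Commun. Math. Phys. 217 (2001) 127–163, §4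
  (4.1)–(4.5), Lemma 4.1 (arXiv:cond-mat/0007425, p. 10).
-/

noncomputable section

open MeasureTheory Set Filter Real
open scoped ENNReal NNReal Topology

namespace Literature.MathematicalPhysics.QuantumManyBody.JelliumBoseGas

open BoseGas Coulomb Literature.Analysis.UnboundedOperators

/-! ### The one-box functional with a general pair kernel -/

/-- The pair potential `∑_{i<j} θ(yᵢ) K(yᵢ - yⱼ) θ(yⱼ)` with kernel `K`. [cite: LiebSolovej2001, (4.5)] -/
def pairK (K : Space → ℝ) (θ : Space → ℝ) {n : ℕ} (Y : Config n) : ℝ :=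
  ∑ i, ∑ j with i < j, θ (Y i) * K (Y i - Y j) * θ (Y j)

/-- The smeared background with kernel `K`: `U_K(x) = ∫ θ(y) K(x - y) dy`. [cite: LiebSolovej2001, (4.5)] -/
def backgroundK (K : Space → ℝ) (θ : Space → ℝ) (x : Space) : ℝ := ∫ y, θ y * K (x - y)

/-- The particle–background potential `∑ⱼ θ(yⱼ) U_K(yⱼ) = ∑ⱼ ∫ w_K(yⱼ, y) dy`.
[cite: LiebSolovej2001, (4.5)] -/
def oneBodyK (K : Space → ℝ) (θ : Space → ℝ) {n : ℕ} (Y : Config n) : ℝ :=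
  ∑ j, θ (Y j) * backgroundK K θ (Y j)

/-- The background self-energy `½∬ w_K = ½ ∫ θ U_K`. [cite: LiebSolovej2001, (4.5)] -/
def selfEnergyK (K : Space → ℝ) (θ : Space → ℝ) : ℝ := 1 / 2 * ∫ x, θ x * backgroundK K θ x

variable {n : ℕ} {ℓ : ℝ}

/-- The pair expectation `∫_{Λ^n} (∑_{i<j} w_K)|Φ|²`. [cite: LiebSolovej2001, (4.5)] -/
def pairExpectationK (K : Space → ℝ) (θ : Space → ℝ) (Φ : NeumannTrialState n ℓ) : ℝ≥0∞ :=
  ∫⁻ Y in boxN n ℓ, ENNReal.ofReal (pairK K θ Y) * (‖Φ.ψ Y‖₊ : ℝ≥0∞) ^ 2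

/-- The particle–background expectation `∫_{Λ^n} (∑ⱼ∫w_K(yⱼ,y)dy)|Φ|²`. [cite: LiebSolovej2001, (4.5)] -/
def oneBodyExpectationK (K : Space → ℝ) (θ : Space → ℝ) (Φ : NeumannTrialState n ℓ) : ℝ≥0∞ :=
  ∫⁻ Y in boxN n ℓ, ENNReal.ofReal (oneBodyK K θ Y) * (‖Φ.ψ Y‖₊ : ℝ≥0∞) ^ 2

/-- **The quadratic form of the one-box Hamiltonian with kernel `K`**:
`κ∫|∇Φ|² + g(∫∑_{i<j}w_K|Φ|² - ρ∫∑ⱼ∫w_K(yⱼ,y)dy|Φ|² + ρ²·½∬w_K)`; for `K = V_{r,R}` this is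
`H^n_{ℓ,r,R}` (4.5), for `K = Y_ν` it is `H^n_ℓ` (3.9) (`boxEnergy`). [cite: LiebSolovej2001, (4.5)] -/
def boxEnergyK (κ g ρ : ℝ) (K : Space → ℝ) (θ : Space → ℝ) (Φ : NeumannTrialState n ℓ) : ℝ :=
  κ * (boxKinetic Φ).toReal + g * ((pairExpectationK K θ Φ).toReal -
    ρ * (oneBodyExpectationK K θ Φ).toReal + ρ ^ 2 * selfEnergyK K θ)

/-- The bosonic ground-state energy `inf Spec` of the one-box Hamiltonian with kernel `K`.
[cite: LiebSolovej2001, Lemma 4.1] -/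
def boxGroundStateEnergyK (κ g ρ : ℝ) (K : Space → ℝ) (θ : Space → ℝ) (n : ℕ) (ℓ : ℝ) : ℝ :=
  ⨅ Φ : {Φ : NeumannTrialState n ℓ // IsBoseSymmetric Φ.ψ}, boxEnergyK κ g ρ K θ Φ.1

/-- **The doubly cut-off kernel** `V_{r,R}(x) = Y_{R⁻¹}(x) - Y_{r⁻¹}(x) = (e^{-|x|/R} - e^{-|x|/r})/|x|`.
[cite: LiebSolovej2001, (4.2)] -/
def cutoffKernel (r R : ℝ) (x : Space) : ℝ := yukawa R⁻¹ x - yukawa r⁻¹ x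

/-! ### The Yukawa case is the one-box Hamiltonian of `JelliumBoxHamiltonian.lean` -/

section Bridge

variable {θ : Space → ℝ} {ν : ℝ}

/-- `boxPair` is `pairK` with the Yukawa kernel. [folklore] -/
theorem boxPair_eq_pairK (θ : Space → ℝ) (ν : ℝ) (Y : Config n) :
    boxPair θ ν Y = pairK (yukawa ν) θ Y := rfl

/-- `smearedBackground` is `backgroundK` with the Yukawa kernel. [folklore] -/
theorem smearedBackground_eq_backgroundK (θ : Space → ℝ) (ν : ℝ) :
    smearedBackground θ ν = backgroundK (yukawa ν) θ := rfl

/-- `boxOneBody` is `oneBodyK` with the Yukawa kernel. [folklore] -/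
theorem boxOneBody_eq_oneBodyK (θ : Space → ℝ) (ν : ℝ) (Y : Config n) :
    boxOneBody θ ν Y = oneBodyK (yukawa ν) θ Y := rfl

/-- `boxBackgroundSelfEnergy` is `selfEnergyK` with the Yukawa kernel. [folklore] -/
theorem boxBackgroundSelfEnergy_eq_selfEnergyK (θ : Space → ℝ) (ν : ℝ) :
    boxBackgroundSelfEnergy θ ν = selfEnergyK (yukawa ν) θ := rfl

/-- `boxEnergy` is `boxEnergyK` with the Yukawa kernel. [cite: LiebSolovej2001, (3.9) and (4.5)] -/
theorem boxEnergy_eq_boxEnergyK (κ g ρ : ℝ) (θ : Space → ℝ) (ν : ℝ) (Φ : NeumannTrialState n ℓ) :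
    boxEnergy κ g ρ θ ν Φ = boxEnergyK κ g ρ (yukawa ν) θ Φ := rfl

/-- `boxGroundStateEnergy` is `boxGroundStateEnergyK` with the Yukawa kernel.
[cite: LiebSolovej2001, (3.9) and (4.5)] -/
theorem boxGroundStateEnergy_eq_boxGroundStateEnergyK (κ g ρ : ℝ) (θ : Space → ℝ) (ν : ℝ)
    (n : ℕ) (ℓ : ℝ) :
    boxGroundStateEnergy κ g ρ θ ν n ℓ = boxGroundStateEnergyK κ g ρ (yukawa ν) θ n ℓ := rfl

end Bridge

/-! ### The cutoff kernel -/

section Kernel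

/-- `V_{r,R} ≥ 0` for `0 < r ≤ R` (the Yukawa potential decreases in its parameter).
[cite: LiebSolovej2001, (4.2)] -/
theorem cutoffKernel_nonneg {r R : ℝ} (hr : 0 < r) (hrR : r ≤ R) (x : Space) :
    0 ≤ cutoffKernel r R x := by
  have hab : R⁻¹ ≤ r⁻¹ := (inv_le_inv₀ (hr.trans_le hrR) hr).2 hrR
  unfold cutoffKernel yukawa
  refine sub_nonneg.2 (div_le_div_of_nonneg_right ?_ (norm_nonneg _))
  exact Real.exp_le_exp.2 (by nlinarith [norm_nonneg x])

/-- `V_{r,R} ≤ Y_{R⁻¹} ≤ |x|⁻¹`. [cite: LiebSolovej2001, (4.2)] -/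
theorem cutoffKernel_le_inv_norm {r R : ℝ} (hR : 0 < R) (x : Space) : cutoffKernel r R x ≤ ‖x‖⁻¹ :=
  (sub_le_self _ (yukawa_nonneg _ x)).trans (yukawa_le_inv_norm (inv_pos.2 hR).le x)

/-- `V_{r,R}` is measurable. [folklore] -/
theorem measurable_cutoffKernel (r R : ℝ) : Measurable (cutoffKernel r R) :=
  (measurable_yukawa _).sub (measurable_yukawa _)

/-- `V_{r,R} ∈ L¹(ℝ³)` for `0 < r`, `0 < R`. [folklore] -/
theorem integrable_cutoffKernel {r R : ℝ} (hr : 0 < r) (hR : 0 < R) : Integrable (cutoffKernel r R) :=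
  (integrable_yukawa' (inv_pos.2 hR)).sub (integrable_yukawa' (inv_pos.2 hr))

end Kernel

/-! ### API for a general kernel -/

section General

variable {K θ : Space → ℝ}

/-- `∑_{i<j} θKθ ≥ 0` for `θ, K ≥ 0`. [folklore] -/
theorem pairK_nonneg (hK : ∀ x, 0 ≤ K x) (hθ : ∀ x, 0 ≤ θ x) (Y : Config n) : 0 ≤ pairK K θ Y :=
  Finset.sum_nonneg fun _ _ => Finset.sum_nonneg fun _ _ =>
    mul_nonneg (mul_nonneg (hθ _) (hK _)) (hθ _)

/-- `∑_{i<j} θKθ ≤ ∑_{i<j}|yᵢ - yⱼ|⁻¹` for `0 ≤ θ ≤ 1`, `0 ≤ K ≤ |·|⁻¹`. [folklore] -/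
theorem pairK_le (hK : ∀ x, 0 ≤ K x) (hK1 : ∀ x, K x ≤ ‖x‖⁻¹) (hθ : ∀ x, 0 ≤ θ x)
    (hθ1 : ∀ x, θ x ≤ 1) (Y : Config n) :
    pairK K θ Y ≤ ∑ i, ∑ j with i < j, ‖Y i - Y j‖⁻¹ := by
  unfold pairK
  refine Finset.sum_le_sum fun i _ => Finset.sum_le_sum fun j _ => ?_
  calc θ (Y i) * K (Y i - Y j) * θ (Y j) ≤ 1 * ‖Y i - Y j‖⁻¹ * 1 :=
        mul_le_mul (mul_le_mul (hθ1 _) (hK1 _) (hK _) zero_le_one) (hθ1 _) (hθ _)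
          (mul_nonneg zero_le_one (inv_nonneg.2 (norm_nonneg _)))
    _ = ‖Y i - Y j‖⁻¹ := by ring

/-- `pairK` is measurable on configuration space. [folklore] -/
theorem measurable_pairK (hKm : Measurable K) (hθm : Measurable θ) :
    Measurable fun Y : Config n => pairK K θ Y := by
  unfold pairK
  refine Finset.measurable_sum _ fun i _ => Finset.measurable_sum _ fun j _ => ?_
  have h1 : Measurable fun Y : Config n => Y i - Y j :=
    (measurable_pi_apply i).sub (measurable_pi_apply j)
  exact ((hθm.comp (measurable_pi_apply i)).mul (hKm.comp h1)).mul (hθm.comp (measurable_pi_apply j))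

/-- `U_K ≥ 0` for `θ, K ≥ 0`. [folklore] -/
theorem backgroundK_nonneg (hK : ∀ x, 0 ≤ K x) (hθ : ∀ x, 0 ≤ θ x) (x : Space) :
    0 ≤ backgroundK K θ x :=
  integral_nonneg fun y => mul_nonneg (hθ y) (hK _)

/-- `U_K(x) ≤ ‖K‖₁` for `0 ≤ θ ≤ 1`, `K ≥ 0` integrable. [folklore] -/
theorem backgroundK_le (hK : ∀ x, 0 ≤ K x) (hKi : Integrable K) (hθ : ∀ x, 0 ≤ θ x)
    (hθ1 : ∀ x, θ x ≤ 1) (x : Space) : backgroundK K θ x ≤ ∫ y, K y := by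
  have hKx : Integrable fun y : Space => K (x - y) := hKi.comp_sub_left x
  calc backgroundK K θ x ≤ ∫ y, K (x - y) := by
        refine integral_mono_of_nonneg (Eventually.of_forall fun y => mul_nonneg (hθ y) (hK _)) hKx
          (Eventually.of_forall fun y => ?_)
        calc θ y * K (x - y) ≤ 1 * K (x - y) := mul_le_mul_of_nonneg_right (hθ1 y) (hK _)
          _ = K (x - y) := one_mul _
    _ = ∫ y, K y := integral_sub_left_eq_self K volume x

/-- `U_K` is measurable. [folklore] -/
theorem measurable_backgroundK (hKm : Measurable K) (hθm : Measurable θ) :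
    Measurable (backgroundK K θ) := by
  have hf : Measurable fun q : Space × Space => θ q.2 * K (q.1 - q.2) :=
    (hθm.comp measurable_snd).mul (hKm.comp (measurable_fst.sub measurable_snd))
  exact (hf.stronglyMeasurable.integral_prod_right' (ν := (volume : Measure Space))).measurable

/-- `∑ⱼθ(yⱼ)U_K(yⱼ) ≥ 0`. [folklore] -/
theorem oneBodyK_nonneg (hK : ∀ x, 0 ≤ K x) (hθ : ∀ x, 0 ≤ θ x) (Y : Config n) :
    0 ≤ oneBodyK K θ Y :=
  Finset.sum_nonneg fun _ _ => mul_nonneg (hθ _) (backgroundK_nonneg hK hθ _)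

/-- `∑ⱼθ(yⱼ)U_K(yⱼ) ≤ n ‖K‖₁`. [folklore] -/
theorem oneBodyK_le (hK : ∀ x, 0 ≤ K x) (hKi : Integrable K) (hθ : ∀ x, 0 ≤ θ x)
    (hθ1 : ∀ x, θ x ≤ 1) (Y : Config n) : oneBodyK K θ Y ≤ n * ∫ y, K y := by
  have hI : 0 ≤ ∫ y, K y := integral_nonneg hK
  calc oneBodyK K θ Y ≤ ∑ _j : Fin n, (1 : ℝ) * ∫ y, K y :=
        Finset.sum_le_sum fun j _ => mul_le_mul (hθ1 _) (backgroundK_le hK hKi hθ hθ1 _)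
          (backgroundK_nonneg hK hθ _) zero_le_one
    _ = n * ∫ y, K y := by
        rw [Finset.sum_const, Finset.card_univ, Fintype.card_fin, nsmul_eq_mul, one_mul]

/-- `oneBodyK` is measurable on configuration space. [folklore] -/
theorem measurable_oneBodyK (hKm : Measurable K) (hθm : Measurable θ) :
    Measurable fun Y : Config n => oneBodyK K θ Y := by
  unfold oneBodyK
  exact Finset.measurable_sum _ fun j _ => (hθm.comp (measurable_pi_apply j)).mul
    ((measurable_backgroundK hKm hθm).comp (measurable_pi_apply j))

/-- `½∫θU_K ≥ 0`. [folklore] -/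
theorem selfEnergyK_nonneg (hK : ∀ x, 0 ≤ K x) (hθ : ∀ x, 0 ≤ θ x) : 0 ≤ selfEnergyK K θ :=
  mul_nonneg (by norm_num) (integral_nonneg fun x => mul_nonneg (hθ x) (backgroundK_nonneg hK hθ x))

/-- The pair expectation of a bounded `ψ` on the box is finite. [folklore] -/
theorem setLIntegral_pairK_mul_normSq_ne_top (hK : ∀ x, 0 ≤ K x) (hK1 : ∀ x, K x ≤ ‖x‖⁻¹)
    (hθ : ∀ x, 0 ≤ θ x) (hθ1 : ∀ x, θ x ≤ 1) {ψ : Config n → ℂ} {B : ℝ}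
    (hB : ∀ Y ∈ boxN n ℓ, ‖ψ Y‖ ≤ B) :
    ∫⁻ Y in boxN n ℓ, ENNReal.ofReal (pairK K θ Y) * (‖ψ Y‖₊ : ℝ≥0∞) ^ 2 ≠ ⊤ := by
  have hpt : ∀ Y ∈ boxN n ℓ, ENNReal.ofReal (pairK K θ Y) * (‖ψ Y‖₊ : ℝ≥0∞) ^ 2 ≤
      (∑ i, ∑ j with i < j, ENNReal.ofReal ‖Y i - Y j‖⁻¹) * ENNReal.ofReal (B ^ 2) := by
    intro Y hY
    refine mul_le_mul' ?_ ?_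
    · refine (ENNReal.ofReal_le_ofReal (pairK_le hK hK1 hθ hθ1 Y)).trans (le_of_eq ?_)
      rw [ENNReal.ofReal_sum_of_nonneg fun i _ => Finset.sum_nonneg fun j _ =>
        inv_nonneg.2 (norm_nonneg _)]
      exact Finset.sum_congr rfl fun i _ => ENNReal.ofReal_sum_of_nonneg fun j _ =>
        inv_nonneg.2 (norm_nonneg _)
    · rw [← ofReal_norm_sq_eq]
      exact ENNReal.ofReal_le_ofReal (pow_le_pow_left₀ (norm_nonneg _) (hB Y hY) 2)
  refine ne_top_of_le_ne_top ?_ (setLIntegral_mono' (measurableSet_boxN n ℓ) hpt)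
  rw [lintegral_mul_const' _ _ ENNReal.ofReal_ne_top]
  exact ENNReal.mul_ne_top (setLIntegral_boxN_sum_inv_norm_sub_ne_top n ℓ) ENNReal.ofReal_ne_top

/-- The pair expectation of a trial state is finite. [folklore] -/
theorem pairExpectationK_ne_top (hK : ∀ x, 0 ≤ K x) (hK1 : ∀ x, K x ≤ ‖x‖⁻¹) (hθ : ∀ x, 0 ≤ θ x)
    (hθ1 : ∀ x, θ x ≤ 1) (Φ : NeumannTrialState n ℓ) : pairExpectationK K θ Φ ≠ ⊤ := by
  obtain ⟨B, hB⟩ := exists_bound_on_boxN Φ.contDiff.continuous ℓ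
  exact setLIntegral_pairK_mul_normSq_ne_top hK hK1 hθ hθ1 hB

/-- The particle–background expectation is at most `n‖K‖₁`. [folklore] -/
theorem oneBodyExpectationK_le (hK : ∀ x, 0 ≤ K x) (hKi : Integrable K) (hθ : ∀ x, 0 ≤ θ x)
    (hθ1 : ∀ x, θ x ≤ 1) (Φ : NeumannTrialState n ℓ) :
    oneBodyExpectationK K θ Φ ≤ ENNReal.ofReal (n * ∫ y, K y) := by
  unfold oneBodyExpectationK
  calc _ ≤ ∫⁻ Y in boxN n ℓ, ENNReal.ofReal (n * ∫ y, K y) * (‖Φ.ψ Y‖₊ : ℝ≥0∞) ^ 2 :=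
        lintegral_mono fun Y => mul_le_mul' (ENNReal.ofReal_le_ofReal (oneBodyK_le hK hKi hθ hθ1 Y)) le_rfl
    _ = _ := by rw [lintegral_const_mul' _ _ ENNReal.ofReal_ne_top, Φ.norm_eq, mul_one]

/-- The particle–background expectation is finite. [folklore] -/
theorem oneBodyExpectationK_ne_top (hK : ∀ x, 0 ≤ K x) (hKi : Integrable K) (hθ : ∀ x, 0 ≤ θ x)
    (hθ1 : ∀ x, θ x ≤ 1) (Φ : NeumannTrialState n ℓ) : oneBodyExpectationK K θ Φ ≠ ⊤ :=
  ne_top_of_le_ne_top ENNReal.ofReal_ne_top (oneBodyExpectationK_le hK hKi hθ hθ1 Φ)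

/-- **A priori lower bound** `boxEnergyK ≥ -gρ n ‖K‖₁` (`κ, g, ρ ≥ 0`, `0 ≤ θ ≤ 1`, `K ≥ 0`).
[cite: LiebSolovej2001, §4] -/
theorem boxEnergyK_ge {κ g ρ : ℝ} (hκ : 0 ≤ κ) (hg : 0 ≤ g) (hρ : 0 ≤ ρ) (hK : ∀ x, 0 ≤ K x)
    (hKi : Integrable K) (hθ : ∀ x, 0 ≤ θ x) (hθ1 : ∀ x, θ x ≤ 1) (Φ : NeumannTrialState n ℓ) :
    -(g * ρ * (n * ∫ y, K y)) ≤ boxEnergyK κ g ρ K θ Φ := by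
  have h1 : 0 ≤ (boxKinetic Φ).toReal := ENNReal.toReal_nonneg
  have h2 : 0 ≤ (pairExpectationK K θ Φ).toReal := ENNReal.toReal_nonneg
  have h3 : (oneBodyExpectationK K θ Φ).toReal ≤ n * ∫ y, K y := by
    have h := ENNReal.toReal_mono ENNReal.ofReal_ne_top (oneBodyExpectationK_le hK hKi hθ hθ1 Φ)
    rwa [ENNReal.toReal_ofReal (mul_nonneg (Nat.cast_nonneg _) (integral_nonneg hK))] at h
  have h4 : 0 ≤ selfEnergyK K θ := selfEnergyK_nonneg hK hθ
  unfold boxEnergyK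
  nlinarith [mul_nonneg hg h2, mul_nonneg hκ h1, mul_nonneg (mul_nonneg hg (sq_nonneg ρ)) h4,
    mul_le_mul_of_nonneg_left h3 (mul_nonneg hg hρ)]

/-- The energies of Bose-symmetric trial states are bounded below. [folklore] -/
theorem bddBelow_range_boxEnergyK {κ g ρ : ℝ} (hκ : 0 ≤ κ) (hg : 0 ≤ g) (hρ : 0 ≤ ρ)
    (hK : ∀ x, 0 ≤ K x) (hKi : Integrable K) (hθ : ∀ x, 0 ≤ θ x) (hθ1 : ∀ x, θ x ≤ 1) :
    BddBelow (Set.range fun Φ : {Φ : NeumannTrialState n ℓ // IsBoseSymmetric Φ.ψ} =>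
      boxEnergyK κ g ρ K θ Φ.1) :=
  ⟨-(g * ρ * (n * ∫ y, K y)), by
    rintro _ ⟨Φ, rfl⟩
    exact boxEnergyK_ge hκ hg hρ hK hKi hθ hθ1 Φ.1⟩

/-- **Variational principle** for the kernel-`K` Hamiltonian. [cite: LiebSolovej2001, Lemma 4.1] -/
theorem boxGroundStateEnergyK_le {κ g ρ : ℝ} (hκ : 0 ≤ κ) (hg : 0 ≤ g) (hρ : 0 ≤ ρ)
    (hK : ∀ x, 0 ≤ K x) (hKi : Integrable K) (hθ : ∀ x, 0 ≤ θ x) (hθ1 : ∀ x, θ x ≤ 1)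
    (Φ : NeumannTrialState n ℓ) (hΦ : IsBoseSymmetric Φ.ψ) :
    boxGroundStateEnergyK κ g ρ K θ n ℓ ≤ boxEnergyK κ g ρ K θ Φ :=
  ciInf_le (bddBelow_range_boxEnergyK hκ hg hρ hK hKi hθ hθ1) ⟨Φ, hΦ⟩

/-- **Lower bounds transfer to the infimum** (`ℓ > 0`). [cite: LiebSolovej2001, Lemma 4.1] -/
theorem le_boxGroundStateEnergyK {κ g ρ : ℝ} {K θ : Space → ℝ} (hℓ : 0 < ℓ) {c : ℝ}
    (h : ∀ Φ : NeumannTrialState n ℓ, IsBoseSymmetric Φ.ψ → c ≤ boxEnergyK κ g ρ K θ Φ) :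
    c ≤ boxGroundStateEnergyK κ g ρ K θ n ℓ := by
  haveI := nonempty_isBoseSymmetric n hℓ
  exact le_ciInf fun Φ => h Φ.1 Φ.2

end General

/-! ### Fubini for the background–background term with a general kernel -/

section Fubini

variable {K θ : Space → ℝ}

/-- `(x, y) ↦ θ(x) K(x - y) θ(y)` is integrable on `ℝ³ × ℝ³` for `θ ∈ L¹ ∩ L^∞` measurable and
`K ∈ L¹`. [folklore] -/
theorem integrable_prod_pairKernel (hθm : Measurable θ) (hθi : Integrable θ) {M : ℝ}
    (hθM : ∀ y, ‖θ y‖ ≤ M) (hKi : Integrable K) :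
    Integrable (fun q : Space × Space => θ q.1 * K (q.1 - q.2) * θ q.2) (volume.prod volume) := by
  have h1 : Integrable (fun q : Space × Space => θ q.2 * K (q.1 - q.2)) (volume.prod volume) := by
    have := hθi.convolution_integrand (ContinuousLinearMap.mul ℝ ℝ) hKi
    simpa only [ContinuousLinearMap.mul_apply'] using this
  have hm1 : Measurable fun q : Space × Space => θ q.1 := hθm.comp measurable_fst
  have h2 := h1.bdd_mul (c := M) hm1.aestronglyMeasurable (Eventually.of_forall fun q => hθM q.1)
  refine h2.congr (Eventually.of_forall fun q => ?_)
  simp only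
  ring

/-- **`∬ θ(x)K(x-y)θ(y) = 2·(½∫θU_K) `** (Fubini). [cite: LiebSolovej2001, (4.5)] -/
theorem integral_prod_pairKernel (hθm : Measurable θ) (hθi : Integrable θ) {M : ℝ}
    (hθM : ∀ y, ‖θ y‖ ≤ M) (hKi : Integrable K) :
    ∫ q : Space × Space, θ q.1 * K (q.1 - q.2) * θ q.2 ∂(volume.prod volume) = 2 * selfEnergyK K θ := by
  rw [integral_prod _ (integrable_prod_pairKernel hθm hθi hθM hKi), selfEnergyK]
  rw [show (2 : ℝ) * (1 / 2 * ∫ x, θ x * backgroundK K θ x) = ∫ x, θ x * backgroundK K θ x by ring]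
  refine integral_congr_ae (Eventually.of_forall fun x => ?_)
  simp only [backgroundK]
  rw [← integral_const_mul]
  refine integral_congr_ae (Eventually.of_forall fun y => ?_)
  ring

end Fubini

/-! ### Lemma 4.1, pointwise (electrostatics) -/

section Pointwise

variable {θ : Space → ℝ} {ν r R ρ : ℝ} {n : ℕ}

/-- The subordinated kernel is the Yukawa potential off the origin:
`∫₀^∞ e^{-μ²s} G_s(z) ds = Y_μ(z)/(4π)` (`z ≠ 0`, `μ > 0`). [cite: LiebLoss2001, Thm. 6.23] -/
theorem subordinated_eq_yukawa {μ : ℝ} (hμ : 0 < μ) {z : Space} (hz : z ≠ 0) :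
    ∫ s in Ioi (0 : ℝ), Real.exp (-(μ ^ 2 * s)) * heatKernel s z = (4 * π)⁻¹ * yukawa μ z := by
  rw [(integral_Ioi_exp_neg_mul_heatKernel hz (by positivity : 0 < μ ^ 2)).2, Real.sqrt_sq hμ.le,
    yukawa]
  have hz' : ‖z‖ ≠ 0 := norm_ne_zero_iff.2 hz
  have hπ : (4 : ℝ) * π ≠ 0 := by positivity
  field_simp

/-- The subordinated difference kernel is `V_{r,R}/(4π)` off the origin. [cite: LiebSolovej2001, (4.2)] -/
theorem subordinatedDiff_eq_cutoffKernel (hr : 0 < r) (hR : 0 < R) {z : Space} (hz : z ≠ 0) :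
    ∫ s in Ioi (0 : ℝ), (Real.exp (-((R⁻¹) ^ 2 * s)) - Real.exp (-((r⁻¹) ^ 2 * s))) * heatKernel s z =
      (4 * π)⁻¹ * cutoffKernel r R z := by
  have h1 := integral_Ioi_exp_neg_mul_heatKernel hz (by positivity : 0 < (R⁻¹) ^ 2)
  have h2 := integral_Ioi_exp_neg_mul_heatKernel hz (by positivity : 0 < (r⁻¹) ^ 2)
  simp_rw [sub_mul]
  rw [integral_sub h1.1 h2.1, subordinated_eq_yukawa (inv_pos.2 hR) hz,
    subordinated_eq_yukawa (inv_pos.2 hr) hz, cutoffKernel]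
  ring

/-- Pair terms: `∑_{i<j} θ(xᵢ)θ(xⱼ)k(xᵢ-xⱼ) = (4π)⁻¹ ∑_{i<j} θ(xᵢ)K(xᵢ-xⱼ)θ(xⱼ)` if `k = K/(4π)`
off the origin and the points are distinct. [folklore] -/
theorem sum_pair_eq_inv_mul_pairK {k K : Space → ℝ} (hk : ∀ z : Space, z ≠ 0 → k z = (4 * π)⁻¹ * K z)
    {X : Config n} (hX : Function.Injective X) :
    ∑ i, ∑ j with i < j, θ (X i) * θ (X j) * k (X i - X j) = (4 * π)⁻¹ * pairK K θ X := by
  unfold pairK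
  rw [Finset.mul_sum]
  refine Finset.sum_congr rfl fun i _ => ?_
  rw [Finset.mul_sum]
  refine Finset.sum_congr rfl fun j hj => ?_
  have hij : i < j := (Finset.mem_filter.1 hj).2
  rw [hk _ (sub_ne_zero.2 (hX.ne hij.ne))]
  ring

/-- Background terms: `∫ ρθ(y) k(x-y) dy = (4π)⁻¹ ρ U_K(x)` if `k = K/(4π)` off the origin
(the exceptional point `y = x` is null). [folklore] -/
theorem integral_background_eq_inv_mul_backgroundK {k K : Space → ℝ}
    (hk : ∀ z : Space, z ≠ 0 → k z = (4 * π)⁻¹ * K z) (ρ : ℝ) (x : Space) :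
    ∫ y, ρ * θ y * k (x - y) = (4 * π)⁻¹ * (ρ * backgroundK K θ x) := by
  have hae : ∀ᵐ y : Space ∂volume, y ≠ x :=
    compl_mem_ae_iff.2 (measure_singleton x)
  rw [backgroundK, ← integral_const_mul, ← integral_const_mul]
  refine integral_congr_ae ?_
  filter_upwards [hae] with y hy
  rw [hk _ (sub_ne_zero.2 (Ne.symm hy))]
  ring

/-- Background–background terms: `∬ ρθ ρθ k = (4π)⁻¹ ρ² · 2·(½∫θU_K)` if `k = K/(4π)` off the
origin (the diagonal is null). [folklore] -/
theorem integral_prod_background_eq {k K : Space → ℝ} (hk : ∀ z : Space, z ≠ 0 → k z = (4 * π)⁻¹ * K z)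
    (hθm : Measurable θ) (hθi : Integrable θ) {M : ℝ} (hθM : ∀ y, ‖θ y‖ ≤ M) (hKi : Integrable K)
    (ρ : ℝ) :
    ∫ z : Space × Space, ρ * θ z.1 * (ρ * θ z.2) * k (z.1 - z.2) ∂(volume.prod volume) =
      (4 * π)⁻¹ * (ρ ^ 2 * (2 * selfEnergyK K θ)) := by
  rw [← integral_prod_pairKernel hθm hθi hθM hKi, ← integral_const_mul, ← integral_const_mul]
  refine integral_congr_ae ?_
  filter_upwards [ae_fst_ne_snd] with z hz
  rw [hk _ (sub_ne_zero.2 hz)]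
  ring

/-- The arithmetic of (4.3)+(4.4): undo the normalisation `/(4π)` of the kernels.
[cite: LiebSolovej2001, Lemma 4.1] -/
theorem cutoff_arith {a P1 B1 S1 P2 B2 S2 pV obV seV pY obY seY ρ err1 err2 E1 E2 : ℝ} (ha : 0 < a)
    (h : P2 - B2 + 1 / 2 * S2 - E1 - E2 ≤ P1 - B1 + 1 / 2 * S1)
    (hP2 : P2 = a * pV) (hB2 : B2 = a * (ρ * obV)) (hS2 : S2 = a * (ρ ^ 2 * (2 * seV)))
    (hP1 : P1 = a * pY) (hB1 : B1 = a * (ρ * obY)) (hS1 : S1 = a * (ρ ^ 2 * (2 * seY)))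
    (hE1 : E1 ≤ a * err1) (hE2 : E2 = a * err2) :
    pV - ρ * obV + ρ ^ 2 * seV - (err1 + err2) ≤ pY - ρ * obY + ρ ^ 2 * seY := by
  subst hP2 hB2 hS2 hP1 hB1 hS1 hE2
  have h' : a * (pV - ρ * obV + ρ ^ 2 * seV - (err1 + err2)) ≤ a * (pY - ρ * obY + ρ ^ 2 * seY) := by
    nlinarith
  exact le_of_mul_le_mul_left h' ha

/-- **(4.3)+(4.4) for a configuration of distinct points** [LiebSolovej2001, §4]: for `θ`
measurable and integrable with `0 ≤ θ ≤ 1`, `0 < ν ≤ R⁻¹`, `0 < r ≤ R`, `ρ ≥ 0`, and distinct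
`x₁, …, x_n`, the box potential `∑_{i<j}w - ρ∑ⱼ∫w(xⱼ,y)dy + ½ρ²∬w` built with the kernel `Y_ν` is at
least the one built with `V_{r,R}` minus `½ n R⁻¹ + 4π n ρ r²`
(`Coulomb.coulombCutoff_electrostatic` with weights `θ(xᵢ)` and background `ρθ`).
[cite: LiebSolovej2001, Lemma 4.1] -/
theorem cutoff_electrostatic_pointwise (hθm : Measurable θ) (hθi : Integrable θ)
    (hθ0 : ∀ x, 0 ≤ θ x) (hθ1 : ∀ x, θ x ≤ 1) (hν : 0 < ν) (hνR : ν ≤ R⁻¹) (hr : 0 < r)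
    (hrR : r ≤ R) (hρ : 0 ≤ ρ) {X : Config n} (hX : Function.Injective X) :
    pairK (cutoffKernel r R) θ X - ρ * oneBodyK (cutoffKernel r R) θ X +
        ρ ^ 2 * selfEnergyK (cutoffKernel r R) θ - (1 / 2 * n * R⁻¹ + 4 * π * n * ρ * r ^ 2) ≤
      pairK (yukawa ν) θ X - ρ * oneBodyK (yukawa ν) θ X + ρ ^ 2 * selfEnergyK (yukawa ν) θ := by
  have hR : 0 < R := hr.trans_le hrR
  have hθM : ∀ y, ‖θ y‖ ≤ 1 := fun y => by
    rw [Real.norm_eq_abs, abs_of_nonneg (hθ0 y)]; exact hθ1 y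
  -- the electrostatic inequality with weights `θ(xᵢ)` and background `ρθ`
  have h := coulombCutoff_electrostatic hν hνR hr hrR hX (c := fun i => θ (X i)) (fun i => hθ0 _)
    (fun i => hθ1 _) (g := fun y => ρ * θ y) (hθm.const_mul ρ) (hθi.const_mul ρ) (ρbar := ρ)
    (fun y => mul_nonneg hρ (hθ0 y)) (fun y => mul_le_of_le_one_right hρ (hθ1 y)) rfl rfl rfl rfl
  -- kernel identities off the origin
  have hkY : ∀ z : Space, z ≠ 0 → (∫ s in Ioi (0 : ℝ), Real.exp (-(ν ^ 2 * s)) * heatKernel s z) =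
      (4 * π)⁻¹ * yukawa ν z := fun z hz => subordinated_eq_yukawa hν hz
  have hkV : ∀ z : Space, z ≠ 0 → (∫ s in Ioi (0 : ℝ),
      (Real.exp (-((R⁻¹) ^ 2 * s)) - Real.exp (-((r⁻¹) ^ 2 * s))) * heatKernel s z) =
      (4 * π)⁻¹ * cutoffKernel r R z := fun z hz => subordinatedDiff_eq_cutoffKernel hr hR hz
  -- the one-body sums
  have hBY : ∑ i, θ (X i) * ∫ y, ρ * θ y * ∫ s in Ioi (0 : ℝ), Real.exp (-(ν ^ 2 * s)) * heatKernel s (X i - y) =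
      (4 * π)⁻¹ * (ρ * oneBodyK (yukawa ν) θ X) := by
    unfold oneBodyK
    rw [Finset.mul_sum, Finset.mul_sum]
    refine Finset.sum_congr rfl fun i _ => ?_
    rw [integral_background_eq_inv_mul_backgroundK hkY ρ (X i)]
    ring
  have hBV : ∑ i, θ (X i) * ∫ y, ρ * θ y * ∫ s in Ioi (0 : ℝ),
      (Real.exp (-((R⁻¹) ^ 2 * s)) - Real.exp (-((r⁻¹) ^ 2 * s))) * heatKernel s (X i - y) =
      (4 * π)⁻¹ * (ρ * oneBodyK (cutoffKernel r R) θ X) := by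
    unfold oneBodyK
    rw [Finset.mul_sum, Finset.mul_sum]
    refine Finset.sum_congr rfl fun i _ => ?_
    rw [integral_background_eq_inv_mul_backgroundK hkV ρ (X i)]
    ring
  -- the error terms
  have hE1 : 1 / 2 * ((R⁻¹ - ν) / (4 * π)) * ∑ i, θ (X i) ^ 2 ≤ (4 * π)⁻¹ * (1 / 2 * n * R⁻¹) := by
    have hs : ∑ i, θ (X i) ^ 2 ≤ n := by
      calc ∑ i, θ (X i) ^ 2 ≤ ∑ _i : Fin n, (1 : ℝ) :=
            Finset.sum_le_sum fun i _ => by nlinarith [hθ0 (X i), hθ1 (X i)]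
        _ = n := by simp
    have h2 : 0 ≤ ∑ i, θ (X i) ^ 2 := Finset.sum_nonneg fun i _ => sq_nonneg _
    have key : (R⁻¹ - ν) * ∑ i, θ (X i) ^ 2 ≤ R⁻¹ * n :=
      mul_le_mul (sub_le_self _ hν.le) hs h2 (inv_nonneg.2 hR.le)
    calc 1 / 2 * ((R⁻¹ - ν) / (4 * π)) * ∑ i, θ (X i) ^ 2
        = (8 * π)⁻¹ * ((R⁻¹ - ν) * ∑ i, θ (X i) ^ 2) := by ring
      _ ≤ (8 * π)⁻¹ * (R⁻¹ * n) := mul_le_mul_of_nonneg_left key (by positivity)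
      _ = (4 * π)⁻¹ * (1 / 2 * n * R⁻¹) := by ring
  have hE2 : (n : ℝ) * ρ * r ^ 2 = (4 * π)⁻¹ * (4 * π * n * ρ * r ^ 2) := by
    have hπ : (4 : ℝ) * π ≠ 0 := by positivity
    field_simp
  have key := cutoff_arith (by positivity : (0 : ℝ) < (4 * π)⁻¹) h
    (sum_pair_eq_inv_mul_pairK hkV hX) hBV
    (integral_prod_background_eq hkV hθm hθi hθM (integrable_cutoffKernel hr hR) ρ)
    (sum_pair_eq_inv_mul_pairK hkY hX) hBY
    (integral_prod_background_eq hkY hθm hθi hθM (integrable_yukawa' hν) ρ) hE1 hE2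
  exact key

end Pointwise

/-! ### Lemma 4.1 for the quadratic forms and the ground-state energies -/

section BoxLemma

variable {θ : Space → ℝ} {ν r R : ℝ}

/-- The arithmetic of the integrated inequality. [folklore] -/
theorem boxCutoff_arith {κ g ρ T PV PY BV BY sV sY err : ℝ} (hg : 0 ≤ g)
    (h : PV + ρ * BY + ρ ^ 2 * sV ≤ PY + ρ * BV + (ρ ^ 2 * sY + err)) :
    κ * T + g * (PV - ρ * BV + ρ ^ 2 * sV) - g * err ≤ κ * T + g * (PY - ρ * BY + ρ ^ 2 * sY) := by
  nlinarith [mul_le_mul_of_nonneg_left h hg]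

/-- **[LiebSolovej2001, Lemma 4.1] for the quadratic form**: for every Neumann trial state `Φ` of
`n` particles in `Λ_ℓ`, `0 ≤ θ ≤ 1` measurable and integrable, `0 < ν ≤ R⁻¹`, `0 < r ≤ R`,
`g, ρ ≥ 0`,
`⟨Φ, H^n_{ℓ,r,R} Φ⟩ - g n(½R⁻¹ + 4πρr²) ≤ ⟨Φ, H^n_ℓ Φ⟩`, i.e.
`boxEnergyK κ g ρ V_{r,R} θ Φ - g n(½R⁻¹ + 4πρr²) ≤ boxEnergy κ g ρ θ ν Φ`.
[cite: LiebSolovej2001, Lemma 4.1] -/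
theorem boxEnergyK_cutoff_le {κ g ρ : ℝ} (hg : 0 ≤ g) (hρ : 0 ≤ ρ) (hθm : Measurable θ)
    (hθi : Integrable θ) (hθ0 : ∀ x, 0 ≤ θ x) (hθ1 : ∀ x, θ x ≤ 1) (hν : 0 < ν) (hνR : ν ≤ R⁻¹)
    (hr : 0 < r) (hrR : r ≤ R) (Φ : NeumannTrialState n ℓ) :
    boxEnergyK κ g ρ (cutoffKernel r R) θ Φ - g * (n * (1 / 2 * R⁻¹ + 4 * π * ρ * r ^ 2)) ≤
      boxEnergy κ g ρ θ ν Φ := by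
  have hR : 0 < R := hr.trans_le hrR
  set V : Space → ℝ := cutoffKernel r R with hV
  set Y : Space → ℝ := yukawa ν with hY
  have hV0 : ∀ x, 0 ≤ V x := fun x => cutoffKernel_nonneg hr hrR x
  have hV1 : ∀ x, V x ≤ ‖x‖⁻¹ := fun x => cutoffKernel_le_inv_norm hR x
  have hVi : Integrable V := integrable_cutoffKernel hr hR
  have hY0 : ∀ x, 0 ≤ Y x := fun x => yukawa_nonneg ν x
  have hY1 : ∀ x, Y x ≤ ‖x‖⁻¹ := fun x => yukawa_le_inv_norm hν.le x
  have hYi : Integrable Y := integrable_yukawa' hν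
  set err : ℝ := n * (1 / 2 * R⁻¹ + 4 * π * ρ * r ^ 2) with herr
  have herr0 : 0 ≤ err := by positivity
  -- the pointwise inequality, rearranged with nonnegative terms, a.e. on the box
  have hpt : ∀ᵐ X : Config n ∂(volume.restrict (boxN n ℓ)),
      (ENNReal.ofReal (pairK V θ X) + ENNReal.ofReal ρ * ENNReal.ofReal (oneBodyK Y θ X) +
          ENNReal.ofReal (ρ ^ 2 * selfEnergyK V θ)) * (‖Φ.ψ X‖₊ : ℝ≥0∞) ^ 2 ≤
        (ENNReal.ofReal (pairK Y θ X) + ENNReal.ofReal ρ * ENNReal.ofReal (oneBodyK V θ X) +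
          ENNReal.ofReal (ρ ^ 2 * selfEnergyK Y θ + err)) * (‖Φ.ψ X‖₊ : ℝ≥0∞) ^ 2 := by
    filter_upwards [ae_restrict_of_ae (ae_injective n)] with X hX
    refine mul_le_mul' ?_ le_rfl
    have h := cutoff_electrostatic_pointwise hθm hθi hθ0 hθ1 hν hνR hr hrR hρ hX
    have e : (1 / 2 * n * R⁻¹ + 4 * π * n * ρ * r ^ 2 : ℝ) = err := by rw [herr]; ring
    rw [e] at h
    have hreal : pairK V θ X + ρ * oneBodyK Y θ X + ρ ^ 2 * selfEnergyK V θ ≤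
        pairK Y θ X + ρ * oneBodyK V θ X + (ρ ^ 2 * selfEnergyK Y θ + err) := by linarith
    have h1 := pairK_nonneg hV0 hθ0 X
    have h2 := mul_nonneg hρ (oneBodyK_nonneg hY0 hθ0 X)
    have h3 := mul_nonneg (sq_nonneg ρ) (selfEnergyK_nonneg hV0 hθ0)
    have h4 := pairK_nonneg hY0 hθ0 X
    have h5 := mul_nonneg hρ (oneBodyK_nonneg hV0 hθ0 X)
    have h6 := add_nonneg (mul_nonneg (sq_nonneg ρ) (selfEnergyK_nonneg hY0 hθ0)) herr0
    rw [← ENNReal.ofReal_mul hρ, ← ENNReal.ofReal_mul hρ, ← ENNReal.ofReal_add h1 h2,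
      ← ENNReal.ofReal_add (add_nonneg h1 h2) h3, ← ENNReal.ofReal_add h4 h5,
      ← ENNReal.ofReal_add (add_nonneg h4 h5) h6]
    exact ENNReal.ofReal_le_ofReal hreal
  -- integrate over the box
  have hW : Measurable fun X : Config n => (‖Φ.ψ X‖₊ : ℝ≥0∞) ^ 2 := measurable_normSq_trial Φ
  have hmPV : Measurable fun X : Config n => ENNReal.ofReal (pairK V θ X) * (‖Φ.ψ X‖₊ : ℝ≥0∞) ^ 2 :=
    (measurable_pairK (measurable_cutoffKernel r R) hθm).ennreal_ofReal.mul hW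
  have hmPY : Measurable fun X : Config n => ENNReal.ofReal (pairK Y θ X) * (‖Φ.ψ X‖₊ : ℝ≥0∞) ^ 2 :=
    (measurable_pairK (measurable_yukawa ν) hθm).ennreal_ofReal.mul hW
  have hmBY : Measurable fun X : Config n =>
      ENNReal.ofReal ρ * ENNReal.ofReal (oneBodyK Y θ X) * (‖Φ.ψ X‖₊ : ℝ≥0∞) ^ 2 :=
    (((measurable_oneBodyK (measurable_yukawa ν) hθm).ennreal_ofReal).const_mul _).mul hW
  have hmBV : Measurable fun X : Config n =>
      ENNReal.ofReal ρ * ENNReal.ofReal (oneBodyK V θ X) * (‖Φ.ψ X‖₊ : ℝ≥0∞) ^ 2 :=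
    (((measurable_oneBodyK (measurable_cutoffKernel r R) hθm).ennreal_ofReal).const_mul _).mul hW
  have hmL : Measurable fun X : Config n => ENNReal.ofReal (pairK V θ X) * (‖Φ.ψ X‖₊ : ℝ≥0∞) ^ 2 +
      ENNReal.ofReal ρ * ENNReal.ofReal (oneBodyK Y θ X) * (‖Φ.ψ X‖₊ : ℝ≥0∞) ^ 2 := hmPV.add hmBY
  have hmR : Measurable fun X : Config n => ENNReal.ofReal (pairK Y θ X) * (‖Φ.ψ X‖₊ : ℝ≥0∞) ^ 2 +
      ENNReal.ofReal ρ * ENNReal.ofReal (oneBodyK V θ X) * (‖Φ.ψ X‖₊ : ℝ≥0∞) ^ 2 := hmPY.add hmBV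
  have hint := lintegral_mono_ae hpt
  simp only [add_mul] at hint
  rw [lintegral_add_left hmL, lintegral_add_left hmPV,
    lintegral_add_left hmR, lintegral_add_left hmPY,
    lintegral_const_mul' _ _ ENNReal.ofReal_ne_top, lintegral_const_mul' _ _ ENNReal.ofReal_ne_top,
    Φ.norm_eq, mul_one, mul_one] at hint
  simp_rw [mul_assoc (ENNReal.ofReal ρ)] at hint
  rw [lintegral_const_mul' _ _ ENNReal.ofReal_ne_top, lintegral_const_mul' _ _ ENNReal.ofReal_ne_top] at hint
  -- finiteness and passage to reals
  have hPVt : pairExpectationK V θ Φ ≠ ⊤ := pairExpectationK_ne_top hV0 hV1 hθ0 hθ1 Φ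
  have hPYt : pairExpectationK Y θ Φ ≠ ⊤ := pairExpectationK_ne_top hY0 hY1 hθ0 hθ1 Φ
  have hBVt : oneBodyExpectationK V θ Φ ≠ ⊤ := oneBodyExpectationK_ne_top hV0 hVi hθ0 hθ1 Φ
  have hBYt : oneBodyExpectationK Y θ Φ ≠ ⊤ := oneBodyExpectationK_ne_top hY0 hYi hθ0 hθ1 Φ
  change pairExpectationK V θ Φ + ENNReal.ofReal ρ * oneBodyExpectationK Y θ Φ +
      ENNReal.ofReal (ρ ^ 2 * selfEnergyK V θ) ≤
    pairExpectationK Y θ Φ + ENNReal.ofReal ρ * oneBodyExpectationK V θ Φ +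
      ENNReal.ofReal (ρ ^ 2 * selfEnergyK Y θ + err) at hint
  have hsV := mul_nonneg (sq_nonneg ρ) (selfEnergyK_nonneg hV0 hθ0)
  have hsY := mul_nonneg (sq_nonneg ρ) (selfEnergyK_nonneg hY0 hθ0)
  have hreal : (pairExpectationK V θ Φ).toReal + ρ * (oneBodyExpectationK Y θ Φ).toReal + ρ ^ 2 * selfEnergyK V θ ≤
      (pairExpectationK Y θ Φ).toReal + ρ * (oneBodyExpectationK V θ Φ).toReal + (ρ ^ 2 * selfEnergyK Y θ + err) := by
    have hl : pairExpectationK V θ Φ + ENNReal.ofReal ρ * oneBodyExpectationK Y θ Φ +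
        ENNReal.ofReal (ρ ^ 2 * selfEnergyK V θ) ≠ ⊤ :=
      ENNReal.add_ne_top.2 ⟨ENNReal.add_ne_top.2 ⟨hPVt, ENNReal.mul_ne_top ENNReal.ofReal_ne_top hBYt⟩,
        ENNReal.ofReal_ne_top⟩
    have hr' : pairExpectationK Y θ Φ + ENNReal.ofReal ρ * oneBodyExpectationK V θ Φ +
        ENNReal.ofReal (ρ ^ 2 * selfEnergyK Y θ + err) ≠ ⊤ :=
      ENNReal.add_ne_top.2 ⟨ENNReal.add_ne_top.2 ⟨hPYt, ENNReal.mul_ne_top ENNReal.ofReal_ne_top hBVt⟩,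
        ENNReal.ofReal_ne_top⟩
    have h := (ENNReal.toReal_le_toReal hl hr').2 hint
    rw [ENNReal.toReal_add (ENNReal.add_ne_top.2 ⟨hPVt, ENNReal.mul_ne_top ENNReal.ofReal_ne_top hBYt⟩)
        ENNReal.ofReal_ne_top,
      ENNReal.toReal_add hPVt (ENNReal.mul_ne_top ENNReal.ofReal_ne_top hBYt),
      ENNReal.toReal_add (ENNReal.add_ne_top.2 ⟨hPYt, ENNReal.mul_ne_top ENNReal.ofReal_ne_top hBVt⟩)
        ENNReal.ofReal_ne_top,
      ENNReal.toReal_add hPYt (ENNReal.mul_ne_top ENNReal.ofReal_ne_top hBVt),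
      ENNReal.toReal_mul, ENNReal.toReal_mul, ENNReal.toReal_ofReal hρ,
      ENNReal.toReal_ofReal hsV, ENNReal.toReal_ofReal (add_nonneg hsY herr0)] at h
    exact h
  unfold boxEnergyK boxEnergy
  rw [boxPairExpectation, boxOneBodyExpectation]
  change κ * (boxKinetic Φ).toReal + g * ((pairExpectationK V θ Φ).toReal -
      ρ * (oneBodyExpectationK V θ Φ).toReal + ρ ^ 2 * selfEnergyK V θ) - g * err ≤
    κ * (boxKinetic Φ).toReal + g * ((pairExpectationK Y θ Φ).toReal -
      ρ * (oneBodyExpectationK Y θ Φ).toReal + ρ ^ 2 * selfEnergyK Y θ)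
  exact boxCutoff_arith hg hreal

/-- **[LiebSolovej2001, Lemma 4.1] (long and short distance potential cutoffs)**: for `ℓ > 0`,
`κ, g, ρ ≥ 0`, `0 ≤ θ ≤ 1` measurable and integrable, `0 < ν ≤ R⁻¹`, `0 < r ≤ R`, the bosonic
ground-state energies satisfy
`inf Spec H^n_{ℓ,r,R} - g n(½R⁻¹ + 4πρr²) ≤ inf Spec H^n_ℓ`
(`H^n_ℓ ≥ H^n_{ℓ,r,R} - ½nR⁻¹ - const₁ nρr²` with `const₁ = 4π`, coupling `g`).
[cite: LiebSolovej2001, Lemma 4.1] -/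
theorem boxGroundStateEnergyK_cutoff_le {κ g ρ : ℝ} (hκ : 0 ≤ κ) (hg : 0 ≤ g) (hρ : 0 ≤ ρ)
    (hθm : Measurable θ) (hθi : Integrable θ) (hθ0 : ∀ x, 0 ≤ θ x) (hθ1 : ∀ x, θ x ≤ 1)
    (hν : 0 < ν) (hνR : ν ≤ R⁻¹) (hr : 0 < r) (hrR : r ≤ R) (hℓ : 0 < ℓ) :
    boxGroundStateEnergyK κ g ρ (cutoffKernel r R) θ n ℓ - g * (n * (1 / 2 * R⁻¹ + 4 * π * ρ * r ^ 2)) ≤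
      boxGroundStateEnergy κ g ρ θ ν n ℓ := by
  have hR : 0 < R := hr.trans_le hrR
  refine le_boxGroundStateEnergy hℓ fun Φ hΦ => ?_
  calc boxGroundStateEnergyK κ g ρ (cutoffKernel r R) θ n ℓ - g * (n * (1 / 2 * R⁻¹ + 4 * π * ρ * r ^ 2))
      ≤ boxEnergyK κ g ρ (cutoffKernel r R) θ Φ - g * (n * (1 / 2 * R⁻¹ + 4 * π * ρ * r ^ 2)) :=
        sub_le_sub_right (boxGroundStateEnergyK_le hκ hg hρ (cutoffKernel_nonneg hr hrR)
          (integrable_cutoffKernel hr hR) hθ0 hθ1 Φ hΦ) _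
    _ ≤ boxEnergy κ g ρ θ ν Φ := boxEnergyK_cutoff_le hg hρ hθm hθi hθ0 hθ1 hν hνR hr hrR Φ

end BoxLemma

end Literature.MathematicalPhysics.QuantumManyBody.JelliumBoseGas
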